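import Literature.Computability.FineGrained.IPRenameOdometer
import HarnessLib

/-!
# The renaming machine of Impagliazzo–Paturi's Lemma 2, XVII: the Y-table of an f-vector

Family `fine-grained` (trunk T-CPLX-FINE). Seventeenth file of the machine half of Impagliazzo–Paturi's Lemma 2: for the current
`f`-vector, the `Y`-table `wYT (ytab P F)` (`IPRenameTables.lean`: per nonempty block, `f_i`
blanks, then the `s_i - f_i` consecutive renaming indices from `yOff i`).

* bricks: `tallyB` (count blanks), `pairOff` (unary subtraction), `revD` (a digit word with the
  digits reversed, by a sentinel comma and a pour: `reverse_comma_dW`), `emitNum` (the renaming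
  counter as a token, then `incrG`);
* `blockY` / `ytBody` / `ytBuild m` with **`runs_ytBuild`** (`yt := ytW fs ss y0`), and the
  identification **`ytW_eq_wYT`**: with `P.fv` of length `numNB` dominated by the nonempty block
  sizes `sizesNB`, `ytW P.fv (sizesNB P F) |aList| = wYT (ytab P F)` (`fAt_eq_getElem`,
  `ytW_drop_eq` along `yOff`).

## References

* R. Impagliazzo, R. Paturi, *On the complexity of k-SAT*, J. Comput. System Sci. 62 (2001)
  367–375, doi:10.1006/jcss.2000.1727, Lemma 2 (p. 373) and its "Moreover" sentence (the
  reduction is computable within the stated time); pp. 371–372 (`G_x`, `Ψ`, `Θ_i`, `Φ_f`).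
  (Not held; acquisition request acq-00143.)
* T. Nipkow, G. Klein, *Concrete Semantics with Isabelle/HOL*, Springer 2014, Ch. 7 (big-step
  reasoning about loops, as in `SymbolPrograms.lean`).
-/

namespace Literature.Computability.FineGrained.IPRenameM

open _root_.Computability Complexity Complexity.ACom Sparsifier IPRename
open Compaction (uflag uflag_true uflag_false)

/-! ### Bricks for the per-vector work: tallies, pairing off, reversing a digit word -/

/-- Count the blanks of `src` (consumed) as ticks onto `dst`. [folklore] -/
def tallyB (src dst : Reg) : RProg := loop src fun s => match s with
  | Γ'.blank => push dst Γ'.blank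
  | _ => skip

/-- **`tallyB`.** [folklore] -/
theorem runs_tallyB {src dst : Reg} (hsd : src ≠ dst) : ∀ (u : List Γ') (R : RStore), R src = u →
    Runs (tallyB src dst) R (Function.update (Function.update R src []) dst (ticks Γ'.blank (u.count Γ'.blank) ++ R dst)) (3 * u.length + 1)
  | [], R, h => by
    refine (Runs.loop_nil _ h).of_eq ?_ (by simp)
    rw [List.count_nil, ticks_zero, List.nil_append, Function.update_eq_self_iff.2 (by simp [hsd.symm]), Function.update_eq_self_iff.2 h.symm]
  | s :: u, R, h => by
    have hb : Runs (match s with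
        | Γ'.blank => push dst Γ'.blank
        | _ => skip) (Function.update R src u) (Function.update (Function.update R src u) dst ((if s = Γ'.blank then [Γ'.blank] else []) ++ R dst)) 1 := by
      cases s with
      | blank => exact Runs.push' (by simp [hsd.symm])
      | _ => exact (Runs.skip _).of_eq (by simp [hsd.symm]) (by norm_num)
    have ih := runs_tallyB hsd u (Function.update (Function.update R src u) dst ((if s = Γ'.blank then [Γ'.blank] else []) ++ R dst)) (by simp [hsd])
    unfold tallyB at ih ⊢
    refine (Runs.loop_cons (f := fun s => match s with
        | Γ'.blank => push dst Γ'.blank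
        | _ => skip) h hb ih).of_eq ?_ (show 1 + 2 + (3 * u.length + 1) ≤ 3 * (s :: u).length + 1 by simp; omega)
    funext q
    by_cases q1 : q = dst
    · subst q1
      simp only [Function.update_self, List.count_cons]
      cases s <;> simp [ticks, List.replicate_succ', List.append_assoc]
    by_cases q2 : q = src; · subst q2; simp [hsd]
    simp [q1, q2]

/-- The blanks of a digit word are the digit sum. [folklore] -/
theorem count_blank_dW : ∀ ds : List ℕ, (dW ds).count Γ'.blank = ds.sum
  | [] => rfl
  | d :: ds => by rw [dW_cons, List.count_append, List.count_cons, count_blank_dW ds]; simp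

/-- Remove one tick of `b` for every symbol of `a` (both unary). [folklore] -/
def pairOff (a b : Reg) : RProg := loop a fun _ => pop b fun _ => skip

/-- **`pairOff`.** [folklore] -/
theorem runs_pairOff {a b : Reg} (hab : a ≠ b) : ∀ (i j : ℕ) (R : RStore), R a = ticks Γ'.blank i → R b = ticks Γ'.blank j →
    Runs (pairOff a b) R (Function.update (Function.update R a []) b (ticks Γ'.blank (j - i))) (4 * i + 1)
  | 0, j, R, ha, hb => by
    refine (Runs.loop_nil _ ha).of_eq ?_ (by simp)
    rw [Nat.sub_zero, ← hb, Function.update_eq_self_iff.2 (by simp [hab.symm])]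
    exact (Function.update_eq_self_iff.2 (by rw [ha]; rfl)).symm
  | i + 1, j, R, ha, hb => by
    rw [ticks_succ] at ha
    have hbody : Runs (pop b fun _ => skip) (Function.update R a (ticks Γ'.blank i)) (Function.update (Function.update R a (ticks Γ'.blank i)) b (ticks Γ'.blank (j - 1))) 2 := by
      cases j with
      | zero => exact (Runs.pop_nil (by simp [hab.symm, hb, ticks]) ((Runs.skip _).of_eq (by simp [hab.symm, hb, ticks]) le_rfl))
      | succ j =>
        refine Runs.pop_cons (k := b) (a := Γ'.blank) (w := ticks Γ'.blank j) (by simp [hab.symm, hb, ticks_succ]) ((Runs.skip _).of_eq ?_ le_rfl)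
        simp
    have ih := runs_pairOff hab i (j - 1) (Function.update (Function.update R a (ticks Γ'.blank i)) b (ticks Γ'.blank (j - 1))) (by simp [hab]) (by simp)
    unfold pairOff at ih ⊢
    refine (Runs.loop_cons (f := fun _ => pop b fun _ => skip) ha hbody ih).of_eq ?_ (by omega)
    rw [show j - 1 - i = j - (i + 1) by omega]
    funext q
    by_cases q1 : q = b; · subst q1; simp
    by_cases q2 : q = a; · subst q2; simp [hab]
    simp [q1, q2]

/-- Reversing a digit word with a sentinel comma gives the digit word of the reversed digits.
[folklore] -/
theorem reverse_comma_dW : ∀ ds : List ℕ, (Γ'.comma :: dW ds).reverse = Γ'.comma :: dW ds.reverse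
  | [] => rfl
  | d :: ds => by
    rw [dW_cons, List.reverse_cons, show (List.replicate d Γ'.blank ++ Γ'.comma :: dW ds) = (List.replicate d Γ'.blank) ++ (Γ'.comma :: dW ds) from rfl,
      List.reverse_append, reverse_comma_dW ds, List.reverse_replicate, List.reverse_cons]
    simp [dW, List.flatMap_append]

/-- `revD src dst tmp`: write the digit word of `src` (kept) with the digits in reverse order into
`dst` (empty before). [folklore] -/
def revD (src dst tmp : Reg) : RProg :=
  copyToG src tmp (kr KR.t1) (kr KR.t2) ;; push tmp Γ'.comma ;; pour tmp dst ;; pop dst fun _ => skip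

/-- **`revD`.** [folklore] -/
theorem runs_revD {src dst tmp : Reg} (hst : src ≠ tmp) (hdt : dst ≠ tmp) (hs1 : src ≠ kr KR.t1) (hs2 : src ≠ kr KR.t2)
    (htm1 : tmp ≠ kr KR.t1) (htm2 : tmp ≠ kr KR.t2) (ds : List ℕ) (R : RStore)
    (hsrc : R src = dW ds) (hdst : R dst = []) (htmp : R tmp = []) (ht1 : R (kr KR.t1) = []) (ht2 : R (kr KR.t2) = []) :
    Runs (revD src dst tmp) R (Function.update R dst (dW ds.reverse)) (13 * (dW ds).length + 10) := by
  unfold revD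
  have h1 := runs_copyToG (a := src) (b := tmp) (t₁ := kr KR.t1) (t₂ := kr KR.t2) hst hs1 hs2 htm1 htm2 (by simp) R ht1 ht2 htmp
  rw [hsrc] at h1
  have h2 : Runs (push tmp Γ'.comma) (Function.update R tmp (dW ds)) (Function.update R tmp (Γ'.comma :: dW ds)) 1 := Runs.push' (by simp)
  have h3 := runs_pour (a := tmp) (b := dst) hdt.symm (Function.update R tmp (Γ'.comma :: dW ds))
  rw [Function.update_self, Function.update_of_ne hdt, hdst, List.append_nil, reverse_comma_dW, Function.update_idem] at h3
  have h4 : Runs (pop dst fun _ => skip) (Function.update (Function.update R tmp []) dst (Γ'.comma :: dW ds.reverse)) (Function.update R dst (dW ds.reverse)) 2 := by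
    refine Runs.pop_cons (k := dst) (a := Γ'.comma) (w := dW ds.reverse) (by simp) ((Runs.skip _).of_eq ?_ le_rfl)
    rw [Function.update_idem, Function.update_comm (Ne.symm hdt)]
    exact Function.update_eq_self_iff.2 (by rw [Function.update_of_ne (Ne.symm hdt)]; exact htmp.symm)
  refine (h1.seq (h2.seq (h3.seq h4))).mono ?_
  simp only [List.length_cons]; omega

/-! ### The `Y`-table of an `f`-vector: programs -/

/-- Emit the current renaming index (in `ycnt`, binary) as a token onto `ytw` and increment it.
[folklore] -/
def emitNum : RProg :=
  copyToG (kr KR.ycnt) (kr KR.s6) (kr KR.t1) (kr KR.t2) ;; (loop (kr KR.s6) fun s => push (kr KR.ytw) s) ;; push (kr KR.ytw) Γ'.comma ;;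
  incrG (kr KR.ycnt) (kr KR.fl2) (kr KR.s7)

/-- One block of the `Y`-table: `f_i` blanks (read off the reversed `f`-digits in `s1`), a comma,
the `s_i - f_i` next index tokens (size read off the reversed size digits in `s3`), a ket.
[folklore] -/
def blockY (m : ℕ) : RProg :=
  readD (kr KR.s1) (kr KR.u1) (m + 1) ;; copyToG (kr KR.u1) (kr KR.cnt) (kr KR.t1) (kr KR.t2) ;;
  (loop (kr KR.u1) fun s => push (kr KR.ytw) s) ;; push (kr KR.ytw) Γ'.comma ;;
  readD (kr KR.s3) (kr KR.u2) (m + 1) ;; pairOff (kr KR.cnt) (kr KR.u2) ;; (loop (kr KR.u2) fun _ => emitNum) ;; push (kr KR.ytw) Γ'.ket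

/-- Body of the block loop. [folklore] -/
def ytBody (m : ℕ) : RProg :=
  blockY m ;; ifTop (kr KR.s1) fun o => match o with
    | some _ => push (kr KR.fl) Γ'.blank
    | none => skip

/-- **`ytBuild m`**: the `Y`-table of the current `f`-vector into `yt`. [folklore] -/
def ytBuild (m : ℕ) : RProg :=
  revD (kr KR.fv) (kr KR.s1) (kr KR.fv2) ;; revD (kr KR.szs) (kr KR.s3) (kr KR.szs2) ;; copyToG (kr KR.na) (kr KR.ycnt) (kr KR.t1) (kr KR.t2) ;;
  (ifTop (kr KR.s1) fun o => match o with
    | some _ => push (kr KR.fl) Γ'.blank ;; whileLoop (kr KR.fl) (ytBody m)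
    | none => skip) ;;
  pour (kr KR.ytw) (kr KR.yt) ;; clear (kr KR.ycnt)

/-- The `Y`-table word of the `f`-digits `fs` against the sizes `ss` (block order), first renaming
index `y`. [folklore] -/
def ytW : List ℕ → List ℕ → ℕ → List Γ'
  | f :: fs, s :: ss, y => wYBlock f ((List.range (s - f)).map (y + ·)) ++ ytW fs ss (y + (s - f))
  | _, _, _ => []

/-- The store family `ySTy` over a base store. [folklore] -/
def ySTy (S : RStore) (s1 s3 u1 u2 cnt ytw ycnt s6 fl : List Γ') : RStore := fun r =>
  if r = kr KR.s1 then s1 else if r = kr KR.s3 then s3 else if r = kr KR.u1 then u1 else if r = kr KR.u2 then u2 else if r = kr KR.cnt then cnt else if r = kr KR.ytw then ytw else if r = kr KR.ycnt then ycnt else if r = kr KR.s6 then s6 else if r = kr KR.fl then fl else S r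

section YstyLemmas

variable (S : RStore) (s1 s3 u1 u2 cnt ytw ycnt s6 fl w : List Γ')

/-- Reading `s1`. [folklore] -/
@[simp] theorem ySTy_s1 : ySTy S s1 s3 u1 u2 cnt ytw ycnt s6 fl (kr KR.s1) = s1 := by simp [ySTy]
/-- Reading `s3`. [folklore] -/
@[simp] theorem ySTy_s3 : ySTy S s1 s3 u1 u2 cnt ytw ycnt s6 fl (kr KR.s3) = s3 := by simp [ySTy]
/-- Reading `u1`. [folklore] -/
@[simp] theorem ySTy_u1 : ySTy S s1 s3 u1 u2 cnt ytw ycnt s6 fl (kr KR.u1) = u1 := by simp [ySTy]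
/-- Reading `u2`. [folklore] -/
@[simp] theorem ySTy_u2 : ySTy S s1 s3 u1 u2 cnt ytw ycnt s6 fl (kr KR.u2) = u2 := by simp [ySTy]
/-- Reading `cnt`. [folklore] -/
@[simp] theorem ySTy_cnt : ySTy S s1 s3 u1 u2 cnt ytw ycnt s6 fl (kr KR.cnt) = cnt := by simp [ySTy]
/-- Reading `ytw`. [folklore] -/
@[simp] theorem ySTy_ytw : ySTy S s1 s3 u1 u2 cnt ytw ycnt s6 fl (kr KR.ytw) = ytw := by simp [ySTy]
/-- Reading `ycnt`. [folklore] -/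
@[simp] theorem ySTy_ycnt : ySTy S s1 s3 u1 u2 cnt ytw ycnt s6 fl (kr KR.ycnt) = ycnt := by simp [ySTy]
/-- Reading `s6`. [folklore] -/
@[simp] theorem ySTy_s6 : ySTy S s1 s3 u1 u2 cnt ytw ycnt s6 fl (kr KR.s6) = s6 := by simp [ySTy]
/-- Reading `fl`. [folklore] -/
@[simp] theorem ySTy_fl : ySTy S s1 s3 u1 u2 cnt ytw ycnt s6 fl (kr KR.fl) = fl := by simp [ySTy]
/-- Reading any other register. [folklore] -/
theorem ySTy_other {r : Reg} (h0 : r ≠ kr KR.s1) (h1 : r ≠ kr KR.s3) (h2 : r ≠ kr KR.u1) (h3 : r ≠ kr KR.u2) (h4 : r ≠ kr KR.cnt) (h5 : r ≠ kr KR.ytw) (h6 : r ≠ kr KR.ycnt) (h7 : r ≠ kr KR.s6) (h8 : r ≠ kr KR.fl) :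
    ySTy S s1 s3 u1 u2 cnt ytw ycnt s6 fl r = S r := by simp [ySTy, h0, h1, h2, h3, h4, h5, h6, h7, h8]
/-- Reading `t1`. [folklore] -/
@[simp] theorem ySTy_t1 : ySTy S s1 s3 u1 u2 cnt ytw ycnt s6 fl (kr KR.t1) = S (kr KR.t1) := by simp [ySTy]
/-- Reading `t2`. [folklore] -/
@[simp] theorem ySTy_t2 : ySTy S s1 s3 u1 u2 cnt ytw ycnt s6 fl (kr KR.t2) = S (kr KR.t2) := by simp [ySTy]
/-- Reading `fl2`. [folklore] -/
@[simp] theorem ySTy_fl2 : ySTy S s1 s3 u1 u2 cnt ytw ycnt s6 fl (kr KR.fl2) = S (kr KR.fl2) := by simp [ySTy]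
/-- Reading `s7`. [folklore] -/
@[simp] theorem ySTy_s7 : ySTy S s1 s3 u1 u2 cnt ytw ycnt s6 fl (kr KR.s7) = S (kr KR.s7) := by simp [ySTy]
/-- Reading `na`. [folklore] -/
@[simp] theorem ySTy_na : ySTy S s1 s3 u1 u2 cnt ytw ycnt s6 fl (kr KR.na) = S (kr KR.na) := by simp [ySTy]
/-- Reading `yt`. [folklore] -/
@[simp] theorem ySTy_yt : ySTy S s1 s3 u1 u2 cnt ytw ycnt s6 fl (kr KR.yt) = S (kr KR.yt) := by simp [ySTy]
/-- Reading `fv`. [folklore] -/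
@[simp] theorem ySTy_fv : ySTy S s1 s3 u1 u2 cnt ytw ycnt s6 fl (kr KR.fv) = S (kr KR.fv) := by simp [ySTy]
/-- Reading `szs`. [folklore] -/
@[simp] theorem ySTy_szs : ySTy S s1 s3 u1 u2 cnt ytw ycnt s6 fl (kr KR.szs) = S (kr KR.szs) := by simp [ySTy]
/-- Updating `s1`. [folklore] -/
@[simp] theorem update_ySTy_s1 : Function.update (ySTy S s1 s3 u1 u2 cnt ytw ycnt s6 fl) (kr KR.s1) w = ySTy S w s3 u1 u2 cnt ytw ycnt s6 fl := by
  funext r; by_cases h : r = kr KR.s1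
  · subst h; simp
  · rw [Function.update_of_ne h]; simp [ySTy, h]
/-- Updating `s3`. [folklore] -/
@[simp] theorem update_ySTy_s3 : Function.update (ySTy S s1 s3 u1 u2 cnt ytw ycnt s6 fl) (kr KR.s3) w = ySTy S s1 w u1 u2 cnt ytw ycnt s6 fl := by
  funext r; by_cases h : r = kr KR.s3
  · subst h; simp
  · rw [Function.update_of_ne h]; simp [ySTy, h]
/-- Updating `u1`. [folklore] -/
@[simp] theorem update_ySTy_u1 : Function.update (ySTy S s1 s3 u1 u2 cnt ytw ycnt s6 fl) (kr KR.u1) w = ySTy S s1 s3 w u2 cnt ytw ycnt s6 fl := by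
  funext r; by_cases h : r = kr KR.u1
  · subst h; simp
  · rw [Function.update_of_ne h]; simp [ySTy, h]
/-- Updating `u2`. [folklore] -/
@[simp] theorem update_ySTy_u2 : Function.update (ySTy S s1 s3 u1 u2 cnt ytw ycnt s6 fl) (kr KR.u2) w = ySTy S s1 s3 u1 w cnt ytw ycnt s6 fl := by
  funext r; by_cases h : r = kr KR.u2
  · subst h; simp
  · rw [Function.update_of_ne h]; simp [ySTy, h]
/-- Updating `cnt`. [folklore] -/
@[simp] theorem update_ySTy_cnt : Function.update (ySTy S s1 s3 u1 u2 cnt ytw ycnt s6 fl) (kr KR.cnt) w = ySTy S s1 s3 u1 u2 w ytw ycnt s6 fl := by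
  funext r; by_cases h : r = kr KR.cnt
  · subst h; simp
  · rw [Function.update_of_ne h]; simp [ySTy, h]
/-- Updating `ytw`. [folklore] -/
@[simp] theorem update_ySTy_ytw : Function.update (ySTy S s1 s3 u1 u2 cnt ytw ycnt s6 fl) (kr KR.ytw) w = ySTy S s1 s3 u1 u2 cnt w ycnt s6 fl := by
  funext r; by_cases h : r = kr KR.ytw
  · subst h; simp
  · rw [Function.update_of_ne h]; simp [ySTy, h]
/-- Updating `ycnt`. [folklore] -/
@[simp] theorem update_ySTy_ycnt : Function.update (ySTy S s1 s3 u1 u2 cnt ytw ycnt s6 fl) (kr KR.ycnt) w = ySTy S s1 s3 u1 u2 cnt ytw w s6 fl := by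
  funext r; by_cases h : r = kr KR.ycnt
  · subst h; simp
  · rw [Function.update_of_ne h]; simp [ySTy, h]
/-- Updating `s6`. [folklore] -/
@[simp] theorem update_ySTy_s6 : Function.update (ySTy S s1 s3 u1 u2 cnt ytw ycnt s6 fl) (kr KR.s6) w = ySTy S s1 s3 u1 u2 cnt ytw ycnt w fl := by
  funext r; by_cases h : r = kr KR.s6
  · subst h; simp
  · rw [Function.update_of_ne h]; simp [ySTy, h]
/-- Updating `fl`. [folklore] -/
@[simp] theorem update_ySTy_fl : Function.update (ySTy S s1 s3 u1 u2 cnt ytw ycnt s6 fl) (kr KR.fl) w = ySTy S s1 s3 u1 u2 cnt ytw ycnt s6 w := by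
  funext r; by_cases h : r = kr KR.fl
  · subst h; simp
  · rw [Function.update_of_ne h]; simp [ySTy, h]

end YstyLemmas

/-- Every store is a `ySTy` over itself. [folklore] -/
theorem ySTy_eta (R : RStore) : ySTy R (R (kr KR.s1)) (R (kr KR.s3)) (R (kr KR.u1)) (R (kr KR.u2)) (R (kr KR.cnt)) (R (kr KR.ytw)) (R (kr KR.ycnt)) (R (kr KR.s6)) (R (kr KR.fl)) = R := by
  funext r
  by_cases h0 : r = kr KR.s1; · subst h0; simp
  by_cases h1 : r = kr KR.s3; · subst h1; simp
  by_cases h2 : r = kr KR.u1; · subst h2; simp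
  by_cases h3 : r = kr KR.u2; · subst h3; simp
  by_cases h4 : r = kr KR.cnt; · subst h4; simp
  by_cases h5 : r = kr KR.ytw; · subst h5; simp
  by_cases h6 : r = kr KR.ycnt; · subst h6; simp
  by_cases h7 : r = kr KR.s6; · subst h7; simp
  by_cases h8 : r = kr KR.fl; · subst h8; simp
  rw [ySTy_other _ _ _ _ _ _ _ _ _ _ h0 h1 h2 h3 h4 h5 h6 h7 h8]

/-! ### The `Y`-table of an `f`-vector: specifications -/

/-- `ytW` over a cons. [folklore] -/
theorem ytW_cons (f : ℕ) (fs : List ℕ) (s : ℕ) (ss : List ℕ) (y : ℕ) :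
    ytW (f :: fs) (s :: ss) y = wYBlock f ((List.range (s - f)).map (y + ·)) ++ ytW fs ss (y + (s - f)) := rfl

/-- The renaming counter after the blocks. [folklore] -/
def yEnd : List ℕ → List ℕ → ℕ → ℕ
  | f :: fs, s :: ss, y => yEnd fs ss (y + (s - f))
  | _, _, y => y

/-- `yEnd` is monotone and bounded by the start plus the sizes. [folklore] -/
theorem yEnd_le : ∀ (fs ss : List ℕ) (y : ℕ), y ≤ yEnd fs ss y ∧ yEnd fs ss y ≤ y + ss.sum
  | [], _, y => by simp [yEnd]
  | _ :: _, [], y => by simp [yEnd]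
  | f :: fs, s :: ss, y => by
    have := yEnd_le fs ss (y + (s - f))
    rw [yEnd]; simp only [List.sum_cons]; omega

section YSpec

variable (S : RStore) (m : ℕ) (ht1 : S (kr KR.t1) = []) (ht2 : S (kr KR.t2) = []) (hfl2 : S (kr KR.fl2) = []) (hs7 : S (kr KR.s7) = [])
include ht1 ht2 hfl2 hs7

/-- **`emitNum`.** [folklore] -/
theorem runs_emitNum (s1 s3 u1 u2 cnt ytw fl : List Γ') (y : ℕ) :
    Runs emitNum (ySTy S s1 s3 u1 u2 cnt ytw (bitsN y) [] fl) (ySTy S s1 s3 u1 u2 cnt ((wIdx y).reverse ++ ytw) (bitsN (y + 1)) [] fl)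
      (22 * (bitsN y).length + 14) := by
  unfold emitNum
  have h1 := runs_copyToG (a := kr KR.ycnt) (b := kr KR.s6) (t₁ := kr KR.t1) (t₂ := kr KR.t2)
    (by simp) (by simp) (by simp) (by simp) (by simp) (by simp) (ySTy S s1 s3 u1 u2 cnt ytw (bitsN y) [] fl) (by simp [ht1]) (by simp [ht2]) (by simp)
  rw [ySTy_ycnt, update_ySTy_s6] at h1
  have h2 := runs_moveAll (a := kr KR.s6) (b := kr KR.ytw) (by simp) (bitsN y) (ySTy S s1 s3 u1 u2 cnt ytw (bitsN y) (bitsN y) fl) (by simp)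
  rw [ySTy_ytw, update_ySTy_s6, update_ySTy_ytw] at h2
  have h3 : Runs (push (kr KR.ytw) Γ'.comma) (ySTy S s1 s3 u1 u2 cnt ((bitsN y).reverse ++ ytw) (bitsN y) [] fl)
      (ySTy S s1 s3 u1 u2 cnt (Γ'.comma :: ((bitsN y).reverse ++ ytw)) (bitsN y) [] fl) 1 := Runs.push' (by simp)
  have h4 := runs_incrG (c := kr KR.ycnt) (f := kr KR.fl2) (j := kr KR.s7) (by simp) (by simp) (by simp) y
    (ySTy S s1 s3 u1 u2 cnt (Γ'.comma :: ((bitsN y).reverse ++ ytw)) (bitsN y) [] fl) (by simp) (by simp [hfl2]) (by simp [hs7])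
  rw [update_ySTy_ycnt] at h4
  refine (h1.seq (h2.seq (h3.seq h4))).of_eq ?_ ?_
  · simp [wIdx, List.reverse_append]
  · simp only [List.length_map]; omega

/-- **The token loop**: `r` consecutive indices from `y`. [folklore] -/
theorem runs_numLoop (s1 s3 u1 cnt fl : List Γ') : ∀ (r y : ℕ) (ytw : List Γ'),
    Runs (loop (kr KR.u2) fun _ => emitNum) (ySTy S s1 s3 u1 (ticks Γ'.blank r) cnt ytw (bitsN y) [] fl)
      (ySTy S s1 s3 u1 [] cnt ((((List.range r).map (y + ·)).flatMap wIdx).reverse ++ ytw) (bitsN (y + r)) [] fl)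
      (r * (22 * (y + r) + 16) + 1)
  | 0, y, ytw => by simpa using Runs.loop_nil (k := kr KR.u2) (fun _ => emitNum) (R := ySTy S s1 s3 u1 (ticks Γ'.blank 0) cnt ytw (bitsN y) [] fl) (by simp [ticks])
  | r + 1, y, ytw => by
    have hk : ySTy S s1 s3 u1 (ticks Γ'.blank (r + 1)) cnt ytw (bitsN y) [] fl (kr KR.u2) = Γ'.blank :: ticks Γ'.blank r := by simp [ticks_succ]
    have hb := runs_emitNum S ht1 ht2 hfl2 hs7 s1 s3 u1 (ticks Γ'.blank r) cnt ytw fl y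
    have hb' : Runs emitNum (Function.update (ySTy S s1 s3 u1 (ticks Γ'.blank (r + 1)) cnt ytw (bitsN y) [] fl) (kr KR.u2) (ticks Γ'.blank r))
        (ySTy S s1 s3 u1 (ticks Γ'.blank r) cnt ((wIdx y).reverse ++ ytw) (bitsN (y + 1)) [] fl) (22 * (bitsN y).length + 14) := by
      rw [update_ySTy_u2]; exact hb
    have ih := runs_numLoop s1 s3 u1 cnt fl r (y + 1) ((wIdx y).reverse ++ ytw)
    refine (Runs.loop_cons (f := fun _ => emitNum) hk hb' ih).of_eq ?_ ?_
    · have e : ((List.range (r + 1)).map (y + ·)) = y :: (List.range r).map (y + 1 + ·) := by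
        rw [List.range_succ_eq_map, List.map_cons, List.map_map, Nat.add_zero]
        exact congrArg _ (List.map_congr_left fun i _ => by simp only [Function.comp_apply]; omega)
      rw [e, List.flatMap_cons, List.reverse_append, List.append_assoc, show y + (r + 1) = y + 1 + r by omega]
    · have := length_bitsN_le y
      nlinarith

end YSpec

/-- The cost of one block of the `Y`-table (`Y` bounds the renaming indices). [folklore] -/
def blockYCost (m Y : ℕ) : ℕ := 23 * m + 11 + m * (22 * Y + 16) + 1 + 1

section YSpec2

variable (S : RStore) (m : ℕ) (ht1 : S (kr KR.t1) = []) (ht2 : S (kr KR.t2) = []) (hfl2 : S (kr KR.fl2) = []) (hs7 : S (kr KR.s7) = [])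
include ht1 ht2 hfl2 hs7

/-- **One block of the `Y`-table.** [folklore] -/
theorem runs_blockY (f s : ℕ) (hfs : f ≤ s) (hsm : s ≤ m) (fs ss : List ℕ) (ytw fl : List Γ') (y Y : ℕ) (hY : y + s ≤ Y) :
    Runs (blockY m) (ySTy S (dW (f :: fs)) (dW (s :: ss)) [] [] [] ytw (bitsN y) [] fl)
      (ySTy S (dW fs) (dW ss) [] [] [] ((wYBlock f ((List.range (s - f)).map (y + ·))).reverse ++ ytw) (bitsN (y + (s - f))) [] fl) (blockYCost m Y) := by
  unfold blockY
  have h1 := runs_readD (src := kr KR.s1) (dst := kr KR.u1) (by simp) m f (by omega) (dW fs) (ySTy S (dW (f :: fs)) (dW (s :: ss)) [] [] [] ytw (bitsN y) [] fl)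
    (by rw [ySTy_s1, dW_cons])
  rw [ySTy_u1, List.append_nil, update_ySTy_s1, update_ySTy_u1] at h1
  have h2 := runs_copyToG (a := kr KR.u1) (b := kr KR.cnt) (t₁ := kr KR.t1) (t₂ := kr KR.t2)
    (by simp) (by simp) (by simp) (by simp) (by simp) (by simp) (ySTy S (dW fs) (dW (s :: ss)) (List.replicate f Γ'.blank) [] [] ytw (bitsN y) [] fl)
    (by simp [ht1]) (by simp [ht2]) (by simp)
  rw [ySTy_u1, update_ySTy_cnt, List.length_replicate] at h2
  have h3 := runs_moveAll (a := kr KR.u1) (b := kr KR.ytw) (by simp) (List.replicate f Γ'.blank)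
    (ySTy S (dW fs) (dW (s :: ss)) (List.replicate f Γ'.blank) [] (List.replicate f Γ'.blank) ytw (bitsN y) [] fl) (by simp)
  rw [ySTy_ytw, update_ySTy_u1, update_ySTy_ytw, List.reverse_replicate, List.length_replicate] at h3
  have h4 : Runs (push (kr KR.ytw) Γ'.comma) (ySTy S (dW fs) (dW (s :: ss)) [] [] (List.replicate f Γ'.blank) (List.replicate f Γ'.blank ++ ytw) (bitsN y) [] fl)
      (ySTy S (dW fs) (dW (s :: ss)) [] [] (List.replicate f Γ'.blank) (Γ'.comma :: (List.replicate f Γ'.blank ++ ytw)) (bitsN y) [] fl) 1 := Runs.push' (by simp)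
  have h5 := runs_readD (src := kr KR.s3) (dst := kr KR.u2) (by simp) m s hsm (dW ss)
    (ySTy S (dW fs) (dW (s :: ss)) [] [] (List.replicate f Γ'.blank) (Γ'.comma :: (List.replicate f Γ'.blank ++ ytw)) (bitsN y) [] fl) (by rw [ySTy_s3, dW_cons])
  rw [ySTy_u2, List.append_nil, update_ySTy_s3, update_ySTy_u2] at h5
  have h6 := runs_pairOff (a := kr KR.cnt) (b := kr KR.u2) (by simp) f s
    (ySTy S (dW fs) (dW ss) [] (List.replicate s Γ'.blank) (List.replicate f Γ'.blank) (Γ'.comma :: (List.replicate f Γ'.blank ++ ytw)) (bitsN y) [] fl) (by simp [ticks]) (by simp [ticks])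
  rw [update_ySTy_cnt, update_ySTy_u2] at h6
  have h7 := runs_numLoop S ht1 ht2 hfl2 hs7 (dW fs) (dW ss) [] [] fl (s - f) y (Γ'.comma :: (List.replicate f Γ'.blank ++ ytw))
  set out := ((((List.range (s - f)).map (y + ·)).flatMap wIdx).reverse ++ Γ'.comma :: (List.replicate f Γ'.blank ++ ytw)) with hout
  have h8 : Runs (push (kr KR.ytw) Γ'.ket) (ySTy S (dW fs) (dW ss) [] [] [] out (bitsN (y + (s - f))) [] fl)
      (ySTy S (dW fs) (dW ss) [] [] [] (Γ'.ket :: out) (bitsN (y + (s - f))) [] fl) 1 := Runs.push' (by simp)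
  refine (h1.seq (h2.seq (h3.seq (h4.seq (h5.seq (h6.seq (h7.seq h8))))))).of_eq ?_ ?_
  · rw [hout, wYBlock]; simp [List.reverse_append]
  · have hr : (s - f) * (22 * (y + (s - f)) + 16) ≤ m * (22 * Y + 16) := Nat.mul_le_mul (by omega) (by omega)
    unfold blockYCost; omega

/-- **The block loop.** [folklore] -/
theorem runs_ytLoop : ∀ (fs ss : List ℕ), List.Forall₂ (· ≤ ·) fs ss → (∀ s ∈ ss, s ≤ m) → fs ≠ [] → ∀ (ytw : List Γ') (y Y : ℕ), y + ss.sum ≤ Y →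
    Runs (whileLoop (kr KR.fl) (ytBody m)) (ySTy S (dW fs) (dW ss) [] [] [] ytw (bitsN y) [] [Γ'.blank])
      (ySTy S [] [] [] [] [] ((ytW fs ss y).reverse ++ ytw) (bitsN (yEnd fs ss y)) [] []) ((blockYCost m Y + 4 + 2) * fs.length + 1)
  | [], _, _, _, hne, _, _, _, _ => absurd rfl hne
  | _ :: _, [], hF, _, _, _, _, _, _ => by cases hF
  | f :: fs, s :: ss, hF, hss, _, ytw, y, Y, hY => by
    obtain ⟨hfs, hF'⟩ : f ≤ s ∧ List.Forall₂ (· ≤ ·) fs ss := by cases hF with | cons h t => exact ⟨h, t⟩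
    have hsm : s ≤ m := hss s (by simp)
    have hss' : ∀ s' ∈ ss, s' ≤ m := fun s' h => hss s' (by simp [h])
    simp only [List.sum_cons] at hY
    unfold whileLoop
    have hk : ySTy S (dW (f :: fs)) (dW (s :: ss)) [] [] [] ytw (bitsN y) [] [Γ'.blank] (kr KR.fl) = Γ'.blank :: [] := by simp
    have hb := runs_blockY S m ht1 ht2 hfl2 hs7 f s hfs hsm fs ss ytw [] y Y (by omega)
    set out := (wYBlock f ((List.range (s - f)).map (y + ·))).reverse ++ ytw with hout
    have hlen : fs.length = ss.length := hF'.length_eq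
    -- the body: block, then re-arm iff blocks remain
    have hbody : Runs (ytBody m) (Function.update (ySTy S (dW (f :: fs)) (dW (s :: ss)) [] [] [] ytw (bitsN y) [] [Γ'.blank]) (kr KR.fl) [])
        (ySTy S (dW fs) (dW ss) [] [] [] out (bitsN (y + (s - f))) [] (if fs = [] then [] else [Γ'.blank])) (blockYCost m Y + 4) := by
      rw [update_ySTy_fl]; unfold ytBody
      refine hb.seq ?_
      by_cases h0 : fs = []
      · rw [if_pos h0]; subst h0
        exact (Runs.ifTop_nil (R := ySTy S (dW []) (dW ss) [] [] [] out (bitsN (y + (s - f))) [] []) (by simp) (Runs.skip _)).mono (by norm_num)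
      · rw [if_neg h0]
        obtain ⟨f', fs', rfl⟩ := List.exists_cons_of_ne_nil h0
        cases f' with
        | zero =>
          exact Runs.ifTop_cons (R := ySTy S (dW (0 :: fs')) (dW ss) [] [] [] out (bitsN (y + (s - f))) [] []) (x := Γ'.comma) (w := dW fs')
            (by simp [dW_cons]) (Runs.push' (by simp))
        | succ f' =>
          exact Runs.ifTop_cons (R := ySTy S (dW ((f' + 1) :: fs')) (dW ss) [] [] [] out (bitsN (y + (s - f))) [] []) (x := Γ'.blank)
            (w := List.replicate f' Γ'.blank ++ Γ'.comma :: dW fs') (by simp [dW_cons, List.replicate_succ]) (Runs.push' (by simp))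
    rw [ytW_cons, yEnd]
    by_cases h0 : fs = []
    · rw [if_pos h0] at hbody
      subst h0; cases hF'
      have hrest := Runs.loop_nil (k := kr KR.fl) (fun _ => ytBody m) (R := ySTy S (dW []) (dW []) [] [] [] out (bitsN (y + (s - f))) [] []) (by simp)
      refine (Runs.loop_cons (f := fun _ => ytBody m) hk hbody hrest).of_eq ?_ ?_
      · simp [hout, ytW, yEnd]
      · simp only [List.length_singleton]; omega
    · rw [if_neg h0] at hbody
      have ih := runs_ytLoop fs ss hF' hss' h0 out (y + (s - f)) Y (by omega)
      unfold whileLoop at ih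
      refine (Runs.loop_cons (f := fun _ => ytBody m) hk hbody ih).of_eq ?_ ?_
      · simp [hout, List.reverse_append]
      · simp only [List.length_cons]; nlinarith

end YSpec2

/-! ### The `Y`-table of an `f`-vector: the whole builder, and the identification with `ytab` -/

/-- The `Y`-table word is at most `|fs| (m + 2 + m (Y + 1))` long. [folklore] -/
theorem length_ytW_le (m Y : ℕ) : ∀ (fs ss : List ℕ) (y : ℕ), List.Forall₂ (· ≤ ·) fs ss → (∀ s ∈ ss, s ≤ m) → y + ss.sum ≤ Y →
    (ytW fs ss y).length ≤ fs.length * (m + 2 + m * (Y + 1))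
  | [], _, _, _, _, _ => by simp [ytW]
  | _ :: _, [], _, hF, _, _ => by cases hF
  | f :: fs, s :: ss, y, hF, hss, hY => by
    obtain ⟨hfs, hF'⟩ : f ≤ s ∧ List.Forall₂ (· ≤ ·) fs ss := by cases hF with | cons h t => exact ⟨h, t⟩
    have hsm : s ≤ m := hss s (by simp)
    simp only [List.sum_cons] at hY
    rw [ytW_cons, List.length_append]
    have ih := length_ytW_le m Y fs ss (y + (s - f)) hF' (fun s' h => hss s' (by simp [h])) (by omega)
    have hb : (wYBlock f ((List.range (s - f)).map (y + ·))).length ≤ m + 2 + m * (Y + 1) := by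
      simp only [wYBlock, List.length_append, List.length_replicate, List.length_cons, List.length_flatMap, List.map_map, List.length_nil]
      have : (((List.range (s - f)).map ((fun a => (wIdx a).length) ∘ fun x => y + x))).sum ≤ ((List.range (s - f)).map fun _ => Y + 1).sum := by
        refine List.sum_le_sum (fun i hi => ?_)
        have hi' := List.mem_range.1 hi
        simp only [Function.comp_apply, wIdx, List.length_append, List.length_map, List.length_singleton]
        have := TokConv.length_encodeNat_le (y + i); omega
      rw [List.map_const', List.sum_replicate, smul_eq_mul, List.length_range] at this
      have hm : (s - f) * (Y + 1) ≤ m * (Y + 1) := Nat.mul_le_mul_right _ (by omega)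
      omega
    simp only [List.length_cons]; nlinarith

/-- The cost of the `Y`-table builder. [folklore] -/
def ytCost (m Y q Lfv Lsz b0 : ℕ) : ℕ :=
  (13 * Lfv + 10) + (13 * Lsz + 10) + (10 * b0 + 3) + (1 + ((blockYCost m Y + 4 + 2) * q + 1) + 3) + (3 * (q * (m + 2 + m * (Y + 1))) + 1) + (2 * Y + 1)

/-- **Specification of `ytBuild`.** [folklore] -/
theorem runs_ytBuild (S : RStore) (m : ℕ) (ds ss : List ℕ) (y0 Y : ℕ) (hF : List.Forall₂ (· ≤ ·) ds ss) (hss : ∀ s ∈ ss, s ≤ m) (hY : y0 + ss.sum ≤ Y)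
    (hfv : S (kr KR.fv) = dW ds) (hszs : S (kr KR.szs) = dW ss) (hna : S (kr KR.na) = bitsN y0)
    (ht1 : S (kr KR.t1) = []) (ht2 : S (kr KR.t2) = []) (hfl2 : S (kr KR.fl2) = []) (hs7 : S (kr KR.s7) = [])
    (hs1 : S (kr KR.s1) = []) (hs3 : S (kr KR.s3) = []) (hu1 : S (kr KR.u1) = []) (hu2 : S (kr KR.u2) = []) (hcnt : S (kr KR.cnt) = [])
    (hytw : S (kr KR.ytw) = []) (hycnt : S (kr KR.ycnt) = []) (hs6 : S (kr KR.s6) = []) (hfl : S (kr KR.fl) = []) (hfv2 : S (kr KR.fv2) = [])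
    (hszs2 : S (kr KR.szs2) = []) (hyt : S (kr KR.yt) = []) :
    Runs (ytBuild m) S (Function.update S (kr KR.yt) (ytW ds.reverse ss.reverse y0)) (ytCost m Y ds.length (dW ds).length (dW ss).length (bitsN y0).length) := by
  have hFr : List.Forall₂ (· ≤ ·) ds.reverse ss.reverse := List.forall₂_reverse_iff.2 hF
  have hssr : ∀ s ∈ ss.reverse, s ≤ m := fun s h => hss s (List.mem_reverse.1 h)
  have hYr : y0 + ss.reverse.sum ≤ Y := by rw [List.sum_reverse]; exact hY
  have hlen : ds.length = ss.length := hF.length_eq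
  unfold ytBuild
  -- 1./2. the reversed digit words
  have h1 := runs_revD (src := kr KR.fv) (dst := kr KR.s1) (tmp := kr KR.fv2) (by simp) (by simp) (by simp) (by simp) (by simp) (by simp) ds S hfv hs1 hfv2 ht1 ht2
  set S1 := Function.update S (kr KR.s1) (dW ds.reverse) with hS1
  have h2 := runs_revD (src := kr KR.szs) (dst := kr KR.s3) (tmp := kr KR.szs2) (by simp) (by simp) (by simp) (by simp) (by simp) (by simp) ss S1
    (by simp [hS1, hszs]) (by simp [hS1, hs3]) (by simp [hS1, hszs2]) (by simp [hS1, ht1]) (by simp [hS1, ht2])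
  set S2 := Function.update S1 (kr KR.s3) (dW ss.reverse) with hS2
  -- 3. the counter
  have h3 := runs_copyToG (a := kr KR.na) (b := kr KR.ycnt) (t₁ := kr KR.t1) (t₂ := kr KR.t2)
    (by simp) (by simp) (by simp) (by simp) (by simp) (by simp) S2 (by simp [hS2, hS1, ht1]) (by simp [hS2, hS1, ht2]) (by simp [hS2, hS1, hycnt])
  have ena : S2 (kr KR.na) = bitsN y0 := by simp [hS2, hS1, hna]
  rw [ena] at h3
  set S3 := Function.update S2 (kr KR.ycnt) (bitsN y0) with hS3
  have eS3 : ySTy S (dW ds.reverse) (dW ss.reverse) [] [] [] [] (bitsN y0) [] [] = S3 := by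
    funext r
    simp only [hS3, hS2, hS1]
    by_cases g1 : r = kr KR.s1; · subst g1; simp
    by_cases g2 : r = kr KR.s3; · subst g2; simp
    by_cases g3 : r = kr KR.ycnt; · subst g3; simp
    rw [Function.update_of_ne g3, Function.update_of_ne g2, Function.update_of_ne g1]
    by_cases g4 : r = kr KR.u1; · subst g4; simp [hu1]
    by_cases g5 : r = kr KR.u2; · subst g5; simp [hu2]
    by_cases g6 : r = kr KR.cnt; · subst g6; simp [hcnt]
    by_cases g7 : r = kr KR.ytw; · subst g7; simp [hytw]
    by_cases g8 : r = kr KR.s6; · subst g8; simp [hs6]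
    by_cases g9 : r = kr KR.fl; · subst g9; simp [hfl]
    rw [ySTy_other _ _ _ _ _ _ _ _ _ _ g1 g2 g4 g5 g6 g7 g3 g8 g9]
  -- 4. the loop
  have h4 : Runs (ifTop (kr KR.s1) fun o => match o with
      | some _ => push (kr KR.fl) Γ'.blank ;; whileLoop (kr KR.fl) (ytBody m)
      | none => skip) S3 (ySTy S [] [] [] [] [] (ytW ds.reverse ss.reverse y0).reverse (bitsN (yEnd ds.reverse ss.reverse y0)) [] [])
      (1 + ((blockYCost m Y + 4 + 2) * ds.length + 1) + 3) := by
    rw [← eS3]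
    by_cases h0 : ds = []
    · subst h0; cases hF
      refine (Runs.ifTop_nil (by simp) ((Runs.skip _).of_eq ?_ le_rfl)).mono (by omega)
      simp [ytW, yEnd]
    · have hr0 : ds.reverse ≠ [] := by simpa using h0
      obtain ⟨d, ds', hds⟩ := List.exists_cons_of_ne_nil hr0
      have hloop := runs_ytLoop S m ht1 ht2 hfl2 hs7 ds.reverse ss.reverse hFr hssr hr0 [] y0 Y hYr
      rw [List.append_nil, List.length_reverse] at hloop
      have hp : Runs (push (kr KR.fl) Γ'.blank) (ySTy S (dW ds.reverse) (dW ss.reverse) [] [] [] [] (bitsN y0) [] [])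
          (ySTy S (dW ds.reverse) (dW ss.reverse) [] [] [] [] (bitsN y0) [] [Γ'.blank]) 1 := Runs.push' (by simp)
      have hk : ySTy S (dW ds.reverse) (dW ss.reverse) [] [] [] [] (bitsN y0) [] [] (kr KR.s1) = (if d = 0 then Γ'.comma else Γ'.blank) :: (dW (d :: ds')).tail := by
        rw [ySTy_s1, hds, dW_cons]; cases d <;> simp [List.replicate_succ]
      exact (Runs.ifTop_cons hk (hp.seq hloop)).of_eq rfl (by omega)
  -- 5. to `yt`; 6. clear the counter
  set out := ytW ds.reverse ss.reverse y0 with hout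
  set ye := yEnd ds.reverse ss.reverse y0 with hye
  have h5 := runs_pour (a := kr KR.ytw) (b := kr KR.yt) (by simp) (ySTy S [] [] [] [] [] out.reverse (bitsN ye) [] [])
  have eyt : ySTy S [] [] [] [] [] out.reverse (bitsN ye) [] [] (kr KR.yt) = [] := by rw [ySTy_yt]; exact hyt
  rw [ySTy_ytw, eyt, List.append_nil, List.reverse_reverse, List.length_reverse, update_ySTy_ytw] at h5
  have h6 := runs_clear (kr KR.ycnt) (Function.update (ySTy S [] [] [] [] [] [] (bitsN ye) [] []) (kr KR.yt) out)
  have eyc : Function.update (ySTy S [] [] [] [] [] [] (bitsN ye) [] []) (kr KR.yt) out (kr KR.ycnt) = bitsN ye := by simp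
  rw [eyc] at h6
  refine (h1.seq (h2.seq (h3.seq (h4.seq (h5.seq h6))))).of_eq ?_ ?_
  · rw [Function.update_comm (a := kr KR.yt) (b := kr KR.ycnt) (by simp), update_ySTy_ycnt]
    have e0 : ySTy S [] [] [] [] [] [] [] [] [] = S := by
      have e := ySTy_eta S
      rw [hs1, hs3, hu1, hu2, hcnt, hytw, hycnt, hs6, hfl] at e; exact e
    rw [e0]
  · have hl := length_ytW_le m Y ds.reverse ss.reverse y0 hFr hssr hYr
    rw [List.length_reverse, ← hout] at hl
    have hye' : (bitsN ye).length ≤ Y := (length_bitsN_le ye).trans (by have := (yEnd_le ds.reverse ss.reverse y0).2; rw [List.sum_reverse] at this; omega)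
    unfold ytCost
    omega

/-! ### The machine's `Y`-table is the `Y`-table -/

section YTab

variable (P : Params) (F : List (List (ℕ × Bool)))

/-- The sizes of the nonempty blocks, in block order. [folklore] -/
def sizesNB : List ℕ := (List.range (numNB P F)).map fun i => (block P F i).length

/-- With the `f`-vector dominated by the nonempty block sizes, `fAt` is the vector entry.
[folklore] -/
theorem fAt_eq_getElem (hlen : P.fv.length = numNB P F) (hdom : List.Forall₂ (· ≤ ·) P.fv (sizesNB P F)) (i : ℕ) (hi : i < numNB P F) :
    fAt P F i = P.fv[i]'(by omega) := by
  unfold fAt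
  rw [List.getD_eq_getElem _ _ (by omega)]
  have h := List.Forall₂.get hdom (by omega : i < P.fv.length) (by simp [sizesNB]; omega)
  simp only [List.get_eq_getElem, sizesNB, List.getElem_map, List.getElem_range] at h
  exact min_eq_left h

/-- **`ytW` against the nonempty block sizes from `yOff i` is the tail of the `Y`-table word.**
[folklore] -/
theorem ytW_drop_eq (hlen : P.fv.length = numNB P F) (hdom : List.Forall₂ (· ≤ ·) P.fv (sizesNB P F)) :
    ∀ (n k : ℕ), k + n = numNB P F →
      ytW (P.fv.drop k) ((sizesNB P F).drop k) (yOff P F k) =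
        ((List.range (numNB P F)).drop k).flatMap fun i => wYBlock (fAt P F i) ((List.range (ycount P F i)).map (newIdxY P F i))
  | 0, k, hk => by
    rw [List.drop_eq_nil_of_le (by omega), List.drop_eq_nil_of_le (by simp [sizesNB]; omega), List.drop_eq_nil_of_le (by simp; omega)]; rfl
  | n + 1, k, hk => by
    have hk' : k < numNB P F := by omega
    have hsz : (sizesNB P F).length = numNB P F := by simp [sizesNB]
    rw [List.drop_eq_getElem_cons (by omega : k < P.fv.length), List.drop_eq_getElem_cons (by omega : k < (sizesNB P F).length),
      List.drop_eq_getElem_cons (by simp; omega : k < (List.range (numNB P F)).length), ytW_cons, List.flatMap_cons, List.getElem_range,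
      ← ytW_drop_eq hlen hdom n (k + 1) (by omega)]
    have hf : fAt P F k = P.fv[k]'(by omega) := fAt_eq_getElem P F hlen hdom k hk'
    have hs : (sizesNB P F)[k]'(by omega) = (block P F k).length := by simp [sizesNB]
    have hyc : ycount P F k = (sizesNB P F)[k]'(by omega) - P.fv[k]'(by omega) := by rw [ycount, hs, hf]
    rw [yOff_succ, hyc, hf]
    rfl

/-- **The machine's `Y`-table is the `Y`-table.** [folklore] -/
theorem ytW_eq_wYT (hlen : P.fv.length = numNB P F) (hdom : List.Forall₂ (· ≤ ·) P.fv (sizesNB P F)) :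
    ytW P.fv (sizesNB P F) (aList P F).length = wYT (ytab P F) := by
  have := ytW_drop_eq P F hlen hdom (numNB P F) 0 (by omega)
  rw [List.drop_zero, List.drop_zero, List.drop_zero] at this
  rw [show yOff P F 0 = (aList P F).length from rfl] at this
  rw [this, wYT, ytab, List.flatMap_map]

end YTab

end Literature.Computability.FineGrained.IPRenameM
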